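import Mathlib.Algebra.Group.Subgroup.Finite
import Mathlib.Data.Fintype.Card
import Literature.Combinatorics.Additive.TripleProductProperty
import HarnessLib

/-!
# Coset-refined pair packing for TPP triples

ω-census, family (b3).  Framing: lottery ticket; floor = certified bounds/negative ranges.

A general necessary condition, valid in EVERY finite group `G` and for EVERY subgroup `H ≤ G` (no structure
assumed): if `T, U ⊆ G` satisfy the pair condition `t t'⁻¹ u u'⁻¹ = 1 ⇒ t = t', u = u'` (e.g. two sets of a TPP
triple), then `(t, u) ↦ t⁻¹u` is injective on `T × U`, and `t⁻¹ u ∈ H` exactly when `t, u` lie in the same left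
coset of `H`.  Hence

* `card_pairs_inv_mul_mem_le`: `#{(t,u) ∈ T × U : t⁻¹u ∈ H} ≤ |H|` — i.e. `∑_C |T ∩ C| |U ∩ C| ≤ |H|` over the
  left cosets `C` of `H`;
* `card_pairs_inv_mul_not_mem_le`: `#{(t,u) ∈ T × U : t⁻¹u ∉ H} ≤ |G| − |H|`.

For an index-2 subgroup with coset parts `(t₀,t₁)`, `(u₀,u₁)` this reads `t₀u₀ + t₁u₁ ≤ |H|` and
`t₀u₁ + t₁u₀ ≤ |H|` — two halves of the packing bound `|T||U| ≤ |G|`, for each of the three pairs of a TPP triple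
(`TripleProductProperty.pair₁₂/pair₂₃/pair₁₃`).  These quadratic constraints hold for ALL index-2 subgroups
(cyclic or not, any automorphism), unlike the cubic vertex constraints of `DihedralLikeVertexCounting.lean`
(inverting class only; e.g. false in `ℤ₃ × D₁₀`, kit j101144); they are the coset-distribution filter for pattern
scans of the non-inverting class.
-/

namespace Summit.MatrixMultiplication.OmegaCensus

open Literature.Combinatorics.Additive Finset

section Pairs

variable {G : Type*} [Group G] [DecidableEq G]

omit [DecidableEq G] in
/-- The pair condition `t t'⁻¹ · u u'⁻¹ = 1 ⇒ t = t' ∧ u = u'` makes `(t,u) ↦ t⁻¹ u` injective on `T × U`.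
[folklore] -/
theorem injOn_inv_mul_of_pair {T U : Finset G}
    (h : ∀ t ∈ T, ∀ t' ∈ T, ∀ u ∈ U, ∀ u' ∈ U, t * t'⁻¹ * (u * u'⁻¹) = 1 → t = t' ∧ u = u') :
    Set.InjOn (fun p : G × G => p.1⁻¹ * p.2) ↑(T ×ˢ U) := by
  rintro ⟨t, u⟩ hp ⟨t', u'⟩ hp' heq
  simp only [coe_product, Set.mem_prod, mem_coe] at hp hp'
  simp only at heq
  -- `t⁻¹ u = t'⁻¹ u'` gives `t' t⁻¹ · u u'⁻¹ = 1`
  have k1 : t' * t⁻¹ * u = u' := by rw [mul_assoc, heq, ← mul_assoc, mul_inv_cancel, one_mul]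
  have key : t' * t⁻¹ * (u * u'⁻¹) = 1 := by rw [← mul_assoc, k1, mul_inv_cancel]
  obtain ⟨h1, h2⟩ := h t' hp'.1 t hp.1 u hp.2 u' hp'.2 key
  subst h1; subst h2; rfl

variable [Fintype G]

/-- **Coset-refined packing, same coset**: `#{(t,u) ∈ T × U : t⁻¹ u ∈ H} ≤ |H|`. [folklore] -/
theorem card_pairs_inv_mul_mem_le (H : Subgroup G) [DecidablePred (· ∈ H)] {T U : Finset G}
    (h : ∀ t ∈ T, ∀ t' ∈ T, ∀ u ∈ U, ∀ u' ∈ U, t * t'⁻¹ * (u * u'⁻¹) = 1 → t = t' ∧ u = u') :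
    ((T ×ˢ U).filter fun p : G × G => p.1⁻¹ * p.2 ∈ H).card ≤ Fintype.card H := by
  have hinj : Set.InjOn (fun p : G × G => p.1⁻¹ * p.2) ↑((T ×ˢ U).filter fun p : G × G => p.1⁻¹ * p.2 ∈ H) :=
    (injOn_inv_mul_of_pair h).mono (coe_subset.2 (filter_subset _ _))
  calc ((T ×ˢ U).filter fun p : G × G => p.1⁻¹ * p.2 ∈ H).card
      = (((T ×ˢ U).filter fun p : G × G => p.1⁻¹ * p.2 ∈ H).image fun p : G × G => p.1⁻¹ * p.2).card :=
        (card_image_of_injOn hinj).symm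
    _ ≤ (univ.filter fun g : G => g ∈ H).card := by
        apply card_le_card
        intro g hg
        obtain ⟨p, hp, rfl⟩ := mem_image.1 hg
        exact mem_filter.2 ⟨mem_univ _, (mem_filter.1 hp).2⟩
    _ = Fintype.card H := by
        rw [← Fintype.card_coe]
        refine Fintype.card_congr (Equiv.subtypeEquiv (Equiv.refl G) fun g => ?_)
        simp

/-- **Coset-refined packing, different cosets**: `#{(t,u) ∈ T × U : t⁻¹ u ∉ H} ≤ |G| − |H|`. [folklore] -/
theorem card_pairs_inv_mul_not_mem_le (H : Subgroup G) [DecidablePred (· ∈ H)] {T U : Finset G}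
    (h : ∀ t ∈ T, ∀ t' ∈ T, ∀ u ∈ U, ∀ u' ∈ U, t * t'⁻¹ * (u * u'⁻¹) = 1 → t = t' ∧ u = u') :
    ((T ×ˢ U).filter fun p : G × G => p.1⁻¹ * p.2 ∉ H).card ≤ Fintype.card G - Fintype.card H := by
  have hinj : Set.InjOn (fun p : G × G => p.1⁻¹ * p.2) ↑((T ×ˢ U).filter fun p : G × G => p.1⁻¹ * p.2 ∉ H) :=
    (injOn_inv_mul_of_pair h).mono (coe_subset.2 (filter_subset _ _))
  have hH : (univ.filter fun g : G => g ∈ H).card = Fintype.card H := by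
    rw [← Fintype.card_coe]
    refine Fintype.card_congr (Equiv.subtypeEquiv (Equiv.refl G) fun g => ?_)
    simp
  have hcomp : (univ.filter fun g : G => g ∉ H).card = Fintype.card G - Fintype.card H := by
    rw [filter_not, card_sdiff_of_subset (filter_subset _ _), card_univ, hH]
  calc ((T ×ˢ U).filter fun p : G × G => p.1⁻¹ * p.2 ∉ H).card
      = (((T ×ˢ U).filter fun p : G × G => p.1⁻¹ * p.2 ∉ H).image fun p : G × G => p.1⁻¹ * p.2).card :=
        (card_image_of_injOn hinj).symm
    _ ≤ (univ.filter fun g : G => g ∉ H).card := by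
        apply card_le_card
        intro g hg
        obtain ⟨p, hp, rfl⟩ := mem_image.1 hg
        exact mem_filter.2 ⟨mem_univ _, (mem_filter.1 hp).2⟩
    _ = Fintype.card G - Fintype.card H := hcomp

end Pairs

section TPP

variable {G : Type*} [Group G] {S T U : Finset G}

/-- A TPP triple satisfies the pair condition for `(S, T)`. [folklore] -/
theorem pair₁₂_of_tpp (h : TripleProductProperty S T U) (hU : U.Nonempty) :
    ∀ s ∈ S, ∀ s' ∈ S, ∀ t ∈ T, ∀ t' ∈ T, s * s'⁻¹ * (t * t'⁻¹) = 1 → s = s' ∧ t = t' := by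
  obtain ⟨u, hu⟩ := hU
  intro s hs s' hs' t ht t' ht' he
  obtain ⟨h1, h2, -⟩ := h s hs s' hs' t ht t' ht' u hu u hu (by rw [he, mul_inv_cancel, mul_one])
  exact ⟨h1, h2⟩

/-- A TPP triple satisfies the pair condition for `(T, U)`. [folklore] -/
theorem pair₂₃_of_tpp (h : TripleProductProperty S T U) (hS : S.Nonempty) :
    ∀ t ∈ T, ∀ t' ∈ T, ∀ u ∈ U, ∀ u' ∈ U, t * t'⁻¹ * (u * u'⁻¹) = 1 → t = t' ∧ u = u' := by
  obtain ⟨s, hs⟩ := hS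
  intro t ht t' ht' u hu u' hu' he
  obtain ⟨-, h2, h3⟩ := h s hs s hs t ht t' ht' u hu u' hu' (by rw [mul_inv_cancel, one_mul, he])
  exact ⟨h2, h3⟩

/-- A TPP triple satisfies the pair condition for `(S, U)`. [folklore] -/
theorem pair₁₃_of_tpp (h : TripleProductProperty S T U) (hT : T.Nonempty) :
    ∀ s ∈ S, ∀ s' ∈ S, ∀ u ∈ U, ∀ u' ∈ U, s * s'⁻¹ * (u * u'⁻¹) = 1 → s = s' ∧ u = u' := by
  obtain ⟨t, ht⟩ := hT
  intro s hs s' hs' u hu u' hu' he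
  obtain ⟨h1, -, h3⟩ := h s hs s' hs' t ht t ht u hu u' hu' (by rw [mul_inv_cancel, mul_one, he])
  exact ⟨h1, h3⟩

end TPP

end Summit.MatrixMultiplication.OmegaCensus
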